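import Summits.SmoothPoincare4.SmoothPoincare4.Theses.SymplecticOrigami
import Summits.SmoothPoincare4.SmoothPoincare4.Theorems.OrigamiFoldExistence.Negative.ZeroSlack
import Summits.SmoothPoincare4.SmoothPoincare4.Theorems.SymplecticOrigamiOrigamiFoldExistenceStubFakeBallImmersion
import Summits.SmoothPoincare4.SmoothPoincare4.Theorems.SymplecticOrigamiOrigamiFoldExistenceStubMeanConvexReembeddingOfPresentation
import Summits.SmoothPoincare4.SmoothPoincare4.Theorems.SymplecticOrigamiOrigamiFoldExistenceStubMorseFakeBall
import Summits.SmoothPoincare4.SmoothPoincare4.Theorems.SymplecticOrigamiOrigamiFoldExistenceStubRoundCreaseStandard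
import Literature.Topology.FourManifolds.HomotopySpheres
import Literature.Topology.FourManifolds.Morse
import Literature.Topology.FourManifolds.HomotopyS4CompactProofs
import Literature.Topology.FourManifolds.HomotopyS4OrientableProofs

/-!
# Skeleton line `round-trace-continuity` for crux `OrigamiFoldExistence` (stmt-SmoothPoincare4-7844)

LEAD COPY r6 (continuation seat prover-line-stmt-SmoothPoincare4-7844-c1-0, 2026-08-16): same six registered stub
STATEMENTS as seat 0's r5 (no reshape); the five stubs LANDED by seat 0 are now DISCHARGED BY IMPORT of their built
Theorems modules (`stub_fakeBallImmersion` p87196, `stub_meanConvexReembeddingOfPresentation` p90401,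
`stub_morseFakeBall` p89782, `stub_roundCreaseStandard` p82428; `stub_foldDataTransport` = `Negative.foldData_transport`
p72874), so the remaining `sorry`s are exactly the four NAMED debts: `stub_noOneHandles` (= stmt-SmoothPoincare4-0378,
open problem, shared), `stub_lawsonMichelsohn1984` (discharge of the vendored Literature fact
`LawsonMichelsohn1984_meanConvexIsotopy_of_handles`, XL formal), `stub_flatContinuity` (Liu 2022 Thm 1.2, XL),
`stub_meanConvexUnwinding` (PATH — crux-sized: seat 0 `promote-stub`, Disproof.lean §9, this seat's NOTES ## PATH
analysis c1).  NOT re-registered with `ledger skeleton check`: the crux's single-slot stub registry is held by the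
concurrent lead `prover-line-stmt-SmoothPoincare4-7844-1` (line shadow-pleats, sha a9c09d7c…) and a registration would
expire its live stubs.

Seat 0's reshape log (prover-line-stmt-SmoothPoincare4-7844-0, 2026-08-16), r0–r4:
* r0: `stub_foldDataTransport` CLOSED by the landed `Negative.foldData_transport` (p72874); sorries 6 → 5.
* r4 (after wave 2): `stub_fakeBallImmersion` LANDED (p87196; = EuclideanOrigami stmt-7486) and
  `stub_chartEmbedding` LANDED (p87331; no longer needed by the composition, dropped from this file); the L–M step is
  now `stub_meanConvexReembeddingOfPresentation` — HYPOTHESIS the fake ball PRESENTED IN MORSE FORM by `g`, ANTECEDENT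
  the body of the NEW Literature named fact `Literature.Geometry.Riemannian.LawsonMichelsohn1984_meanConvexIsotopy_of_handles`
  (vendored by the wave-2 worker, p86775 ACCEPTED; its discharge is the registered debt stub `stub_lawsonMichelsohn1984`,
  statement = that fact VERBATIM) — closed by the worker's kernel-checked reduction once landed; and the new M-sized
  `stub_morseFakeBall` (from a Morse function without index-1 critical points, a Morse-ball `e` and a Morse-form
  presentation `g` of `Δ_e`; no disc theorem).  All registered stub statements are written FULLY EXPANDED (no local
  notation, no local predicate) because the gate matches `--supports` files against the registry TEXTUALLY
  (`supports.stub-mismatch`, wave-2 report of stub_chartEmbedding).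
* r3: `stub_meanConvexThickening` RESHAPED into three registered stubs with a proved glue
  (`meanConvexThickening_of`): `stub_chartEmbedding` (S: some smooth embedding ℝ⁴ ↪ S exists),
  `stub_fakeBallImmersion` (= route EuclideanOrigami's support item `HirschPoenaruImmersion`, stmt-SmoothPoincare4-7486,
  VERBATIM — L-sized now that Phillips' h-principle is proved in tree), `stub_meanConvexReembedding` (the Lawson–Michelsohn
  step proper: inside an immersed fake ball of a 1-handle-free homotopy sphere re-embed the ball with mean-convex crease);
  wave-1 worker report work/stubs/stub_meanConvexThickening.report.md §3 is the source of the split.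
* r2: `stub_roundCreaseStandard` CLOSED by the landed stub file `Theorems/SymplecticOrigamiOrigamiFoldExistenceStubRoundCreaseStandard.lean`
  (p82428; helpers p79439, p81799 under EuclideanOrigami); sorries 5 → 4.
* r1: `stub_roundCreaseStandard` RESHAPED — Cerf's `Γ₄ = 0` is moved out of the stub into a BY-NAME route
  hypothesis of the composition (`hC : CerfGammaFour`, item stmt-SmoothPoincare4-8758 of this route, exactly as
  `RoundSphereIsOrigamiFold` already enters); the stub is now VERBATIM the support item `RoundCreaseStandard`
  of route EuclideanOrigami (stmt-SmoothPoincare4-10644: covering lemma + twisted-sphere packaging, no Cerf),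
  so it is staffed once and closable without the XL Cerf debt.  `Unfolded.*` records, for the stub workers,
  the stub statements with this file's local predicates unfolded (Theorems files cannot import Cruxes files)
  together with the definitional implications used to close each `stub_*` by `exact`.

Route `SymplecticOrigami`, crux r4 `OrigamiFoldExistence` (E, zero slack: every smooth homotopy
4-sphere carries the fold data of `OrigamiRung`).  Idea card `Ideas/round-trace-continuity.md`
(crux-ideate r1 k1; triage r1-1: PASS with four sharpenings), restated as the triage asks
("THE FLAT LOCUS ALREADY CLOSES — state the line that way", sharpen (1); "SILENT SCOPE — flat
mean-convex starts exist only on 3-handle-free fake balls", sharpen (2); "TYPING — TraceRung on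
`Δ`, not on `punctured p`", sharpen (3)):

* the fake ball `Δ_e = S ∖ e(B̊⁴)` of a homotopy 4-sphere `S` is studied through codimension-0
  IMMERSIONS `F : Δ_e ↬ ℝ⁴` (typed exactly as in route `EuclideanOrigami`: `e : ℝ⁴ → S` a smooth
  embedding, `F : S → ℝ⁴` a local diffeomorphism at every point outside `e(B̊⁴)`; the CREASE is the
  immersed 3-sphere `F ∘ e | S³`), i.e. through FLAT hyperkähler triples `F*θ` on `Δ_e` — the
  canonical start of the card's continuity method, on which the symplectic form `F*θ₁` with round
  trace is read off at the end;
* `stub_noOneHandles` [Kirby 4.18 for homotopy spheres; VERBATIM the crux `NoohNoOneHandles` of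
  route `NoOneHandles`, stmt-SmoothPoincare4-0378 — the scope of flat mean-convex starts made
  explicit]: every homotopy 4-sphere has a Morse function without index-1 critical points;
* `stub_meanConvexThickening` [MC-START engine, Lawson–Michelsohn]: then some immersed fake ball
  of `S` has MEAN-CONVEX crease (mean curvature vector pointing to the `Δ`-side), written
  elementarily through `fderiv` (`CreaseMeanConvexAt`: the trace of `⟪(Dg)⁻¹ D²g[w,w], u⟫ - ‖w‖²`
  over a `Dg`-orthonormal tangent frame is positive; for the round model `g = ι` (inversion) it is
  `6 - 3 = 3 = H(S³) > 0`);
* `stub_meanConvexUnwinding` [PATH, HARDEST]: such a crease unwinds to a ROUND sphere through a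
  regular homotopy of collar germs `g t` that stays mean-convex (`IsMeanConvexUnwinding`);
* `stub_flatContinuity` [MCR = the card's OPEN + CLOSED steps on the flat locus]: along such a path
  the immersion of `Δ_e` persists — openness by collar interpolation, closedness by Liu's
  compactness theorem for hyperkähler triples with mean-convex boundary framings (arXiv:2202.07151
  Thm 1.2: no `(-2)`-classes on `Δ_e` since `H₂ = 0`; the limit flat triple develops into `ℝ⁴` and
  its boundary framing fixes the crease up to rigid motion, Fine–Lotay–Singer arXiv:1603.08170 p. 5
  / Liu p. 2) — so at `t = 1` some immersed fake ball has a ROUND crease;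
* `stub_roundCreaseStandard` [the card's TraceRung on the flat locus = route EuclideanOrigami's
  `RoundCreaseStandard` without its Cerf antecedent]: a round crease makes `F` a covering of the
  round ball, `Δ_e ≅ D⁴`, `S` a twisted sphere, `S ≅ S⁴` (Cerf `Γ₄ = 0`);
* `stub_foldDataTransport`: the typed fold data transport along a diffeomorphism; with the route's
  own support item `RoundSphereIsOrigamiFold` (S⁴ is a fold, CdGP Ex. 2.3/2.6) this turns `M ≅ S⁴`
  into the crux at `M`.

`OrigamiFoldExistence_of` composes the six stubs and the route item `RoundSphereIsOrigamiFold` into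
the crux BY NAME (kernel-checked, no `sorry`; the packaging facts "homotopy S⁴ ⇒ compact /
orientable" are the PROVED tree theorems `compactSpace_of_homotopyEquiv_sphere_four_holds`,
`isOrientable_of_homotopyEquiv_sphere_four_holds`).

Why the handle hypothesis is the honest first stub (triage sharpen (2)): a flat `Δ_e` with
mean-convex (= 3-convex) boundary is a handlebody with handles of index ≤ 2 (Sha, Invent. Math. 83
(1986); J. Differential Geom. 25 (1987)), and conversely an index ≤ 2 handlebody thickens to a
mean-convex (immersed) domain (Lawson–Michelsohn, Invent. Math. 77 (1984), §3); so "some immersed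
fake ball of `S` has mean-convex crease" is EQUIVALENT to "`S` is 1-handle-free (dually
3-handle-free)" modulo theorems, and the line's own content is `stub_meanConvexUnwinding` +
`stub_flatContinuity`: a GEOMETRIC standardisation of 1-handle-free homotopy spheres (no handle
slides, no Property R).  The non-flat torsion-free hypersymplectic enlargement of the card
(Donaldson ellipticity, parity of fillings) is the reserve move for the first stub's scope and is
NOT a stub here (line card §Transfer / §Not in skeleton).

Disproof used: none — no `Disproof.lean` exists for this crux at plan time (payload path absent on
disk; `ledger crux ls` = Ideas + TRIAGE-r1-1 only); `ledger negatives --problem SmoothPoincare4` = 0;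
no `Negative/` lemma landed; dead_lines = [].  Nothing to honour or import; no stub is an instance
of a refuted statement.  Self-identified tightness (for the standing disprover): `FlatContinuity`
is FALSE WITHOUT mean-convexity along the path (4-dimensional dumbbell whose band is driven through
itself: the immersed filling collapses a slab — the line uses `H > 0` exactly at the closedness step
of STUB 4), and `RoundCreaseStandard` needs the whole crease inside ONE round sphere.
-/

noncomputable section

-- the prescribed namespace `Summit.<P>.<Sub>.…` duplicates `SmoothPoincare4` (P = Sub)
set_option linter.dupNamespace false

open scoped Manifold ContDiff Topology RealInnerProductSpace
open Set Function TopologicalSpace ContinuousMap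
open Literature.Topology.FourManifolds (HomotopySphere)
open Summit.SmoothPoincare4.SmoothPoincare4.Theses.SymplecticOrigami (OrigamiFoldExistence
  RoundSphereIsOrigamiFold CerfGammaFour)

namespace Summit.SmoothPoincare4.SmoothPoincare4.Cruxes.OrigamiFoldExistence.RoundTraceContinuity

/-- Local notation: the model space `ℝ⁴`. -/
local notation "E4" => EuclideanSpace ℝ (Fin 4)

/-- Local notation: the round 4-sphere with Mathlib's smooth structure. -/
local notation "𝕊⁴" => (Metric.sphere (0 : EuclideanSpace ℝ (Fin 5)) 1)

/-! ### Vocabulary (plain definitions over Mathlib; no new objects are posited) -/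

/-- `(e, F)` presents an IMMERSED FAKE BALL of the homotopy 4-sphere `S` (route EuclideanOrigami's
convention, items `HirschPoenaruImmersion`, `RoundCreaseStandard`): `e : ℝ⁴ → S` is a smooth
embedding and `F : S → ℝ⁴` is a local diffeomorphism at every point outside `e(B̊⁴)`, i.e. on a
neighbourhood of the fake ball `Δ_e = S ∖ e(B̊⁴)` (so `F ∘ e` is smooth with invertible derivative
on a two-sided neighbourhood of the unit sphere; its restriction to `S³` is the CREASE). -/
def IsImmersedFakeBall (S : HomotopySphere 4) (e : E4 → S.carrier) (F : S.carrier → E4) : Prop :=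
  Manifold.IsSmoothEmbedding (𝓡 4) (𝓡 4) ∞ e ∧
    ∀ x, x ∉ e '' Metric.ball (0 : E4) 1 → IsLocalDiffeomorphAt (𝓡 4) (𝓡 4) ∞ F x

/-- MEAN-CONVEXITY OF A CREASE GERM towards the outside of the unit ball. `g : ℝ⁴ → ℝ⁴` is a
collar germ (a local diffeomorphism near the unit sphere); the immersed hypersurface `g | S³` is
mean-convex at `u ∈ S³` with respect to the side `Dg(u)·u` (the image of `{‖x‖ > 1}`, which is the
`Δ`-side when `g = F ∘ e`) iff its mean-curvature VECTOR has positive component along that side.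
Elementary transcription: the linear form `ℓ(v) = ⟪(Dg u)⁻¹ v, u⟫` vanishes on the tangent space
`Dg(u)(u^⊥)` and is positive on the `Δ`-side; for a curve `γ` on `S³` with `γ(0) = u`, `γ'(0) = w`
one has `(g ∘ γ)'' = D²g(u)[w,w] + Dg(u) γ''` and `ℓ(Dg(u) γ'') = ⟪γ'', u⟫ = -‖w‖²`; so
`ℓ(H⃗) = Σᵢ (⟪(Dg u)⁻¹ D²g(u)[wᵢ,wᵢ], u⟫ - ‖wᵢ‖²)` over any tangent frame `wᵢ ⊥ u` whose image
`Dg(u) wᵢ` is orthonormal (a trace: frame-independent; such frames exist as soon as `Dg(u)` is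
invertible, which every use below guarantees, so the `∀` is never vacuous). Check on the round
model `g = ι`, `ι(x) = x/‖x‖²` (route EuclideanOrigami `RoundModel`, `F ∘ e` = inversion):
`Dι(u) = I - 2uuᵀ`, `D²ι(u)[w,w] = -2‖w‖²u`, each summand `2 - 1`, total `3 = H(S³) > 0`
(mean-convex towards the ball `ι({‖x‖ > 1})`); for `g = id` the inequality reads `3 < 0` (the
exterior of a ball is not mean-convex). Same sign convention as the tree's
`PseudoRiemannianMetric.meanCurvature` for the outward normal of the filled side ("round balls are
mean convex", `MeanConvexContractible.lean`) and as Liu / Fine–Lotay–Singer ("the mean curvature of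
the boundary of the ball in ℝ⁴ is positive", arXiv:1603.08170 p. 18). -/
def CreaseMeanConvexAt (g : E4 → E4) (u : E4) : Prop :=
  ∀ w : Fin 3 → E4, (∀ i, ⟪w i, u⟫ = 0) → Orthonormal ℝ (fun i => fderiv ℝ g u (w i)) →
    ∑ i, ‖w i‖ ^ 2 <
      ∑ i, ⟪(fderiv ℝ g u).inverse (fderiv ℝ (fun x => fderiv ℝ g x (w i)) u (w i)), u⟫

/-- A MEAN-CONVEX UNWINDING: a one-parameter family of collar germs `g t : ℝ⁴ → ℝ⁴`, jointly smooth
near `[0,1] × S³`, each a local diffeomorphism at the points of `S³` (a regular homotopy of immersed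
collars `S³ × (-δ, δ) ↬ ℝ⁴`) with MEAN-CONVEX crease towards the outer side for every `t ∈ [0,1]`,
whose final crease `g 1 | S³` lies in the round sphere of centre `c` and radius `r` (then `r > 0`
and `g 1 | S³` is a covering of it, hence a diffeomorphism onto it; mean-convexity at `t = 1` forces
the outer side to be mapped INTO the round ball). -/
def IsMeanConvexUnwinding (g : ℝ → E4 → E4) (c : E4) (r : ℝ) : Prop :=
  (∀ t ∈ Icc (0 : ℝ) 1, ∀ u : E4, ‖u‖ = 1 →
      ContDiffAt ℝ ∞ (Function.uncurry g) (t, u) ∧ Function.Bijective (fderiv ℝ (g t) u) ∧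
        CreaseMeanConvexAt (g t) u) ∧
    ∀ u : E4, ‖u‖ = 1 → dist (g 1 u) c = r

/-- MC-START at `S` (derived notion, = STUB 1 + STUB 2 at `S`; the triage's [MC-START]): some
immersed fake ball of `S` has mean-convex crease. -/
def MeanConvexStart (S : HomotopySphere 4) : Prop :=
  ∃ (e : E4 → S.carrier) (F : S.carrier → E4),
    IsImmersedFakeBall S e F ∧ ∀ u : E4, ‖u‖ = 1 → CreaseMeanConvexAt (F ∘ e) u

/-- The FOLD DATA of `OrigamiRung` / `OrigamiFoldExistence` on a manifold `M` with the summit's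
binders — VERBATIM the matrix of the crux (`OrigamiFoldExistence = ∀ M …, M ≃ₕ S⁴ → FoldData M`
definitionally; `RoundSphereIsOrigamiFold = FoldData S⁴` definitionally). -/
def FoldData (M : Type) [TopologicalSpace M] [T2Space M] [SecondCountableTopology M]
    [ChartedSpace (EuclideanSpace ℝ (Fin 4)) M] [IsManifold (𝓡 4) ∞ M] : Prop :=
  ∃ (V : Fin 2 → TopologicalSpace.Opens M) (N : Fin 2 → Type) (_ : ∀ i, TopologicalSpace (N i)) (_ : ∀ i, T2Space (N i)) (_ : ∀ i, SecondCountableTopology (N i)) (_ : ∀ i, CompactSpace (N i)) (_ : ∀ i, ConnectedSpace (N i)) (_ : ∀ i, ChartedSpace (EuclideanSpace ℝ (Fin 4)) (N i)) (_ : ∀ i, IsManifold (𝓡 4) ∞ (N i)) (s : ∀ i, Literature.Geometry.Kaehler.MForm (𝓡 4) (N i) ℝ 2) (S : Fin 2 → Type) (_ : ∀ i, TopologicalSpace (S i)) (_ : ∀ i, CompactSpace (S i)) (_ : ∀ i, ConnectedSpace (S i)) (_ : ∀ i, ChartedSpace (EuclideanSpace ℝ (Fin 2)) (S i)) (_ :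 ∀ i, IsManifold (𝓡 2) ∞ (S i)) (b : ∀ i, S i → N i) (β : ∀ i, M → N i), (Disjoint (V 0) (V 1) ∧ (∀ i, (V i : Set M).Nonempty) ∧ IsConnected ((V 0 : Set M) ∪ (V 1 : Set M))ᶜ ∧ (∃ (Z : Type) (_ : TopologicalSpace Z) (_ : ChartedSpace (EuclideanSpace ℝ (Fin 3)) Z) (_ : IsManifold (𝓡 3) ∞ Z) (z : Z → M), Manifold.IsSmoothEmbedding (𝓡 3) (𝓡 4) ∞ z ∧ Set.range z = ((V 0 : Set M) ∪ (V 1 : Set M))ᶜ)) ∧ (∀ i, Literature.Geometry.Kaehler.IsSmoothForm (s i) ∧ Literature.Geometry.Kaehler.IsClosedForm (s i) ∧ (∀ x (v : TangentSpace (𝓡 4) x), v ≠ 0 → ∃ w, s i x ![v, w] ≠ 0) ∧ Manifold.IsSmoothEmbedding (𝓡 2) (𝓡 4) ∞ (b i) ∧ (∀ y (v : TangentSpace (𝓡 2) y), v ≠ 0 → ∃ w : TangentSpace (𝓡 2) y, s i (b i y) ![mfderiv (𝓡 2) (𝓡 4) (b i) y v, mfderiv (𝓡 2) (𝓡 4)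 (b i) y w] ≠ 0) ∧ (∃ U : Set M, IsOpen U ∧ closure (V i : Set M) ⊆ U ∧ ContMDiffOn (𝓡 4) (𝓡 4) ∞ (β i) U) ∧ Set.InjOn (β i) (V i : Set M) ∧ β i '' (V i : Set M) = (Set.range (b i))ᶜ ∧ (∀ x ∈ (V i : Set M), Function.Bijective (mfderiv (𝓡 4) (𝓡 4) (β i) x)) ∧ β i '' frontier (V i : Set M) ⊆ Set.range (b i) ∧ (∀ x ∈ frontier (V i : Set M), Module.finrank ℝ (LinearMap.ker (mfderiv (𝓡 4) (𝓡 4) (β i) x).toLinearMap) = 1))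

/-! ### The six stub STATEMENTS (named `Prop`s; the registered `stub_*` theorems below restate them
verbatim, and `Registered.stub_*` are their name-keyed aliases used as the hypotheses of
`OrigamiFoldExistence_of` — the native skeleton audit admits hypotheses BY NAME; same device as
`Cruxes/MazurKaneLaw/Lines/fibre-toolkit-lp-wall-map.lean`) -/

/-- Statement of STUB 1 [no 1-handles; = `NoohNoOneHandles` of route NoOneHandles, verbatim]. -/
def NoOneHandles : Prop :=
  ∀ S : Literature.Topology.FourManifolds.HomotopySphere 4, ∃ f : S.carrier → ℝ,
    Literature.Topology.FourManifolds.IsMorse (𝓡 4) f ∧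
      Literature.Topology.FourManifolds.criticalSetOfIndex (𝓡 4) f 1 = ∅

/-- Statement of STUB 2 [mean-convex thickening]: a 1-handle-free homotopy sphere has an immersed
fake ball with mean-convex crease. -/
def MeanConvexThickening : Prop :=
  ∀ S : HomotopySphere 4,
    (∃ f : S.carrier → ℝ, Literature.Topology.FourManifolds.IsMorse (𝓡 4) f ∧
        Literature.Topology.FourManifolds.criticalSetOfIndex (𝓡 4) f 1 = ∅) →
      MeanConvexStart S

/-- Statement of STUB 2a [fake balls immerse] (r3) — VERBATIM the support item `HirschPoenaruImmersion` of route
EuclideanOrigami (stmt-SmoothPoincare4-7486); LANDED (p87196). -/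
def FakeBallImmersion : Prop :=
  ∀ (S : Literature.Topology.FourManifolds.HomotopySphere 4) (e : EuclideanSpace ℝ (Fin 4) → S.carrier), Manifold.IsSmoothEmbedding (𝓡 4) (𝓡 4) ∞ e → ∃ F : S.carrier → EuclideanSpace ℝ (Fin 4), ∀ x, x ∉ e '' Metric.ball (0 : EuclideanSpace ℝ (Fin 4)) 1 → IsLocalDiffeomorphAt (𝓡 4) (𝓡 4) ∞ F x

/-- The body of the Literature named fact `Literature.Geometry.Riemannian.LawsonMichelsohn1984_meanConvexIsotopy_of_handles`
(Lawson–Michelsohn 1984 Thm (3.1) + proof of (6.1): in a flat-immersed ambient `(M, F)` a compact domain `{g ≤ 0}`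
presented in Morse form with handles of index `≤ m − 1 = n − 2` is moved by an ambient diffeomorphism, inside itself, to a
domain whose boundary has positive mean curvature read in the flat charts), VERBATIM (r4; vendored p86775). -/
def LawsonMichelsohnFact : Prop :=
  ∀ (m : ℕ) (M : Type) [TopologicalSpace M] [T2Space M] [SecondCountableTopology M] [ChartedSpace (EuclideanSpace ℝ (Fin (m + 1))) M] [IsManifold (𝓡 (m + 1)) ∞ M] (F : M → EuclideanSpace ℝ (Fin (m + 1))) (g : M → ℝ) (V : Set M), ContMDiff (𝓡 (m + 1)) 𝓘(ℝ, ℝ) ∞ g → IsCompact {x | g x ≤ 0} → (∀ x, g x ≤ 0 → IsLocalDiffeomorphAt (𝓡 (m + 1)) (𝓡 (m + 1)) ∞ F x) → (∀ x, g x ≤ 0 → Literature.Topology.FourManifolds.IsMCriticalPt (𝓡 (m + 1)) g x → g x < 0 ∧ (Literature.Topology.FourManifolds.mhessian (𝓡 (m + 1)) g x).Nondegenerate ∧ Literature.Topology.FourManifolds.morseIndex (𝓡 (m + 1)) g x + 1 ≤ m) → IsOpen V → {x | g x ≤ 0} ⊆ V → ∃ φ : M ≃ₘ⟮𝓡 (m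 + 1), 𝓡 (m + 1)⟯ M, (∀ x, x ∉ V → φ x = x) ∧ (∀ x, g x ≤ 0 → g (φ x) ≤ 0) ∧ ∀ y, g (φ.symm y) = 0 → ∀ σ : EuclideanSpace ℝ (Fin (m + 1)) → M, σ (F y) = y → ContMDiffAt (𝓡 (m + 1)) (𝓡 (m + 1)) ∞ σ (F y) → (∀ᶠ z in 𝓝 (F y), F (σ z) = z) → fderiv ℝ (fun z => g (φ.symm (σ z))) (F y) ≠ 0 ∧ ∀ v : Fin m → EuclideanSpace ℝ (Fin (m + 1)), Orthonormal ℝ v → (∀ i, fderiv ℝ (fun z => g (φ.symm (σ z))) (F y) (v i) = 0) → 0 < ∑ i, iteratedFDeriv ℝ 2 (fun z => g (φ.symm (σ z))) (F y) ![v i, v i]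

/-- Statement of STUB 2b' [mean-convex re-embedding OF A PRESENTED fake ball] (r4): under the L–M fact, an immersed fake
ball `(e, F)` of `S` whose `Δ_e` is presented in Morse form by `g` (smooth, `{g ≤ 0} = Δ_e`, critical points in `Δ_e`
interior, nondegenerate, of index `≤ 2`) can be re-embedded, keeping `F`, with MEAN-CONVEX crease. -/
def MeanConvexReembeddingOfPresentation : Prop :=
  (∀ (m : ℕ) (M : Type) [TopologicalSpace M] [T2Space M] [SecondCountableTopology M] [ChartedSpace (EuclideanSpace ℝ (Fin (m + 1))) M] [IsManifold (𝓡 (m + 1)) ∞ M] (F : M → EuclideanSpace ℝ (Fin (m + 1))) (g : M → ℝ) (V : Set M), ContMDiff (𝓡 (m + 1)) 𝓘(ℝ, ℝ) ∞ g → IsCompact {x | g x ≤ 0} → (∀ x, g x ≤ 0 → IsLocalDiffeomorphAt (𝓡 (m + 1)) (𝓡 (m + 1)) ∞ F x) → (∀ x, g x ≤ 0 → Literature.Topology.FourManifolds.IsMCriticalPt (𝓡 (m + 1)) g x → g x < 0 ∧ (Literature.Topology.FourManifolds.mhessian (𝓡 (m + 1)) g x).Nondegenerate ∧ Literature.Topology.FourManifolds.morseIndex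 (𝓡 (m + 1)) g x + 1 ≤ m) → IsOpen V → {x | g x ≤ 0} ⊆ V → ∃ φ : M ≃ₘ⟮𝓡 (m + 1), 𝓡 (m + 1)⟯ M, (∀ x, x ∉ V → φ x = x) ∧ (∀ x, g x ≤ 0 → g (φ x) ≤ 0) ∧ ∀ y, g (φ.symm y) = 0 → ∀ σ : EuclideanSpace ℝ (Fin (m + 1)) → M, σ (F y) = y → ContMDiffAt (𝓡 (m + 1)) (𝓡 (m + 1)) ∞ σ (F y) → (∀ᶠ z in 𝓝 (F y), F (σ z) = z) → fderiv ℝ (fun z => g (φ.symm (σ z))) (F y) ≠ 0 ∧ ∀ v : Fin m → EuclideanSpace ℝ (Fin (m + 1)), Orthonormal ℝ v → (∀ i, fderiv ℝ (fun z => g (φ.symm (σ z))) (F y) (v i) = 0) → 0 < ∑ i, iteratedFDeriv ℝ 2 (fun z => g (φ.symm (σ z))) (F y) ![v i, v i]) → ∀ (S : Literature.Topology.FourManifolds.HomotopySphere 4) (e : EuclideanSpace ℝ (Fin 4) → S.carrier) (F : S.carrier → EuclideanSpace ℝ (Fin 4)) (g : S.carrier → ℝ), ContMDiff (𝓡 4)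 𝓘(ℝ, ℝ) ∞ g → {x | g x ≤ 0} = {x | x ∉ e '' Metric.ball (0 : EuclideanSpace ℝ (Fin 4)) 1} → (∀ x, g x ≤ 0 → Literature.Topology.FourManifolds.IsMCriticalPt (𝓡 4) g x → g x < 0 ∧ (Literature.Topology.FourManifolds.mhessian (𝓡 4) g x).Nondegenerate ∧ Literature.Topology.FourManifolds.morseIndex (𝓡 4) g x + 1 ≤ 3) → (Manifold.IsSmoothEmbedding (𝓡 4) (𝓡 4) ∞ e ∧ ∀ x, x ∉ e '' Metric.ball (0 : EuclideanSpace ℝ (Fin 4)) 1 → IsLocalDiffeomorphAt (𝓡 4) (𝓡 4) ∞ F x) → ∃ e' : EuclideanSpace ℝ (Fin 4) → S.carrier, (Manifold.IsSmoothEmbedding (𝓡 4) (𝓡 4) ∞ e' ∧ ∀ x, x ∉ e' '' Metric.ball (0 : EuclideanSpace ℝ (Fin 4)) 1 → IsLocalDiffeomorphAt (𝓡 4) (𝓡 4) ∞ F x) ∧ ∀ u : EuclideanSpace ℝ (Fin 4), ‖u‖ = 1 → (∀ w : Fin 3 → EuclideanSpace ℝ (Fin 4), (∀ i, ⟪w i,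 u⟫ = 0) → Orthonormal ℝ (fun i => fderiv ℝ (F ∘ e') u (w i)) → ∑ i, ‖w i‖ ^ 2 < ∑ i, ⟪(fderiv ℝ (F ∘ e') u).inverse (fderiv ℝ (fun x => fderiv ℝ (F ∘ e') x (w i)) u (w i)), u⟫)

/-- Statement of STUB 2d [Morse fake ball] (r4; B1-lite of the wave-2 report): a Morse function on `S` without index-1
critical points yields a Morse-ball embedding `e : ℝ⁴ ↪ S` together with a Morse-form presentation `g` of its fake ball
`Δ_e` (−f has no index 3 and one maximum; cut just below it; radial reparametrisation of the Morse chart). -/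
def MorseFakeBall : Prop :=
  ∀ S : Literature.Topology.FourManifolds.HomotopySphere 4, (∃ f : S.carrier → ℝ, Literature.Topology.FourManifolds.IsMorse (𝓡 4) f ∧ Literature.Topology.FourManifolds.criticalSetOfIndex (𝓡 4) f 1 = ∅) → ∃ (e : EuclideanSpace ℝ (Fin 4) → S.carrier) (g : S.carrier → ℝ), Manifold.IsSmoothEmbedding (𝓡 4) (𝓡 4) ∞ e ∧ ContMDiff (𝓡 4) 𝓘(ℝ, ℝ) ∞ g ∧ {x | g x ≤ 0} = {x | x ∉ e '' Metric.ball (0 : EuclideanSpace ℝ (Fin 4)) 1} ∧ ∀ x, g x ≤ 0 → Literature.Topology.FourManifolds.IsMCriticalPt (𝓡 4) g x → g x < 0 ∧ (Literature.Topology.FourManifolds.mhessian (𝓡 4) g x).Nondegenerate ∧ Literature.Topology.FourManifolds.morseIndex (𝓡 4) g x + 1 ≤ 3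

/-- Statement of STUB 3 [PATH, hardest]: the mean-convex crease of an immersed fake ball unwinds
mean-convexly to a round sphere. -/
def MeanConvexUnwinding : Prop :=
  ∀ (S : HomotopySphere 4) (e : E4 → S.carrier) (F : S.carrier → E4),
    IsImmersedFakeBall S e F → (∀ u : E4, ‖u‖ = 1 → CreaseMeanConvexAt (F ∘ e) u) →
      ∃ (g : ℝ → E4 → E4) (c : E4) (r : ℝ), g 0 = F ∘ e ∧ IsMeanConvexUnwinding g c r

/-- Statement of STUB 4 [MCR, flat continuity principle]: along a mean-convex unwinding of its
crease the immersion of the fake ball persists, so some immersed fake ball (same `e`) has the round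
final crease. -/
def FlatContinuity : Prop :=
  ∀ (S : HomotopySphere 4) (e : E4 → S.carrier) (F : S.carrier → E4) (g : ℝ → E4 → E4) (c : E4)
    (r : ℝ), IsImmersedFakeBall S e F → g 0 = F ∘ e → IsMeanConvexUnwinding g c r →
      ∃ F₁ : S.carrier → E4, IsImmersedFakeBall S e F₁ ∧ ∀ u : E4, ‖u‖ = 1 → dist (F₁ (e u)) c = r

/-- Cerf's theorem `Γ₄ = 0` in twisted-sphere form — VERBATIM the body of the route item `CerfGammaFour`
(stmt-SmoothPoincare4-8758) and of the named fact `Literature.Topology.FourManifolds.cerf_twistedSphere_four`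
(lead reshape r1: it is the antecedent of STUB 5 and a by-name hypothesis of the composition). -/
def CerfTwistedSphereFour : Prop :=
  ∀ [Fact (Literature.Topology.FourManifolds.isSmoothEmbedding_sphereInclusion' 3)] (φ : (Metric.sphere (0 : EuclideanSpace ℝ (Fin 4)) 1) ≃ₘ⟮𝓡 3, 𝓡 3⟯ (Metric.sphere (0 : EuclideanSpace ℝ (Fin 4)) 1)) (T : Literature.Topology.FourManifolds.TwistedSphere 3 φ), Nonempty (T.carrier ≃ₘ⟮𝓡 4, 𝓡 4⟯ Metric.sphere (0 : EuclideanSpace ℝ (Fin 5)) 1)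

/-- Statement of STUB 5 [round crease ⇒ standard, UNDER Γ₄ = 0] (lead reshape r1): VERBATIM the support
item `RoundCreaseStandard` of route EuclideanOrigami (stmt-SmoothPoincare4-10644) — under Cerf's theorem in
twisted-sphere form, an immersed fake ball whose crease lies in a round sphere belongs to a standard sphere. -/
def RoundCreaseStandard : Prop :=
  (∀ [Fact (Literature.Topology.FourManifolds.isSmoothEmbedding_sphereInclusion' 3)] (φ : (Metric.sphere (0 : EuclideanSpace ℝ (Fin 4)) 1) ≃ₘ⟮𝓡 3, 𝓡 3⟯ (Metric.sphere (0 : EuclideanSpace ℝ (Fin 4)) 1)) (T : Literature.Topology.FourManifolds.TwistedSphere 3 φ), Nonempty (T.carrier ≃ₘ⟮𝓡 4, 𝓡 4⟯ Metric.sphere (0 : EuclideanSpace ℝ (Fin 5)) 1)) → ∀ (S : Literature.Topology.FourManifolds.HomotopySphere 4) (e : EuclideanSpace ℝ (Fin 4) → S.carrier) (F : S.carrier → EuclideanSpace ℝ (Fin 4)), Manifold.IsSmoothEmbedding (𝓡 4) (𝓡 4) ∞ e → (∀ x, x ∉ e '' Metric.ball (0 : EuclideanSpace ℝ (Fin 4))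 1 → IsLocalDiffeomorphAt (𝓡 4) (𝓡 4) ∞ F x) → (∃ (c : EuclideanSpace ℝ (Fin 4)) (r : ℝ), ∀ u : EuclideanSpace ℝ (Fin 4), ‖u‖ = 1 → dist (F (e u)) c = r) → Nonempty (S.carrier ≃ₘ⟮𝓡 4, 𝓡 4⟯ Metric.sphere (0 : EuclideanSpace ℝ (Fin 5)) 1)

/-- Statement of STUB 6 [transport]: the typed fold data transport along a diffeomorphism. -/
def FoldDataTransport : Prop :=
  ∀ (M : Type) [TopologicalSpace M] [T2Space M] [SecondCountableTopology M]
    [ChartedSpace (EuclideanSpace ℝ (Fin 4)) M] [IsManifold (𝓡 4) ∞ M]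
    (M' : Type) [TopologicalSpace M'] [T2Space M'] [SecondCountableTopology M']
    [ChartedSpace (EuclideanSpace ℝ (Fin 4)) M'] [IsManifold (𝓡 4) ∞ M'],
    Nonempty (M ≃ₘ⟮𝓡 4, 𝓡 4⟯ M') → FoldData M' → FoldData M

/-! ### The registered stubs -/

/-- STUB 1 [no 1-handles] (open-problem; SHARED verbatim with crux `NoohNoOneHandles` of route
NoOneHandles, stmt-SmoothPoincare4-0378 = Kirby Problem 4.18 specialised to homotopy spheres).
Every homotopy 4-sphere carries a Morse function without critical points of index 1 (equivalently,
with `-f`, without index 3: a handle decomposition `0 ∪ 1's ∪ 2's ∪ 4`, i.e. the fake ball is a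
2-HANDLEBODY). Here it is exactly the SCOPE of flat mean-convex starts (triage sharpen (2)): by Sha
(Invent. Math. 83 (1986); J. Differential Geom. 25 (1987)) a flat manifold with mean-convex
boundary is a handlebody of index ≤ 2, and STUB 2 is the converse construction, so this stub is
forced on the flat line, not chosen (main theorems of the two papers; not re-read this session,
searchd unavailable — quoted after Sweeney arXiv:2507.15719 p. 4). Why plausibly true: no homotopy 4-sphere is known to need
1-handles; all standardised families (Cappell–Shaneson, Akbulut–Kirby, Gompf) were presented
1-handle-free; TOP handle trading is available (Freedman). Why it might fail: an exotic (or even the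
standard!) S⁴ with a decomposition-theoretic obstruction to trading 1-handles; the only known
obstructions (Yasui) need b₂⁺ > 1. Sources: Kirby1997 Problem 4.18; GompfStipsicz1999 §5.1;
Yasui2019; Sha1986; Sha1987. Size: open-problem (staffed once, through stmt-0378). -/
theorem stub_noOneHandles :
    ∀ S : Literature.Topology.FourManifolds.HomotopySphere 4, ∃ f : S.carrier → ℝ,
      Literature.Topology.FourManifolds.IsMorse (𝓡 4) f ∧
        Literature.Topology.FourManifolds.criticalSetOfIndex (𝓡 4) f 1 = ∅ := by
  sorry

/-- STUB 2a [fake balls immerse] (r3; LANDED p87196 — discharged below by `exact` of the landed theorem, r6): VERBATIM route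
EuclideanOrigami's `HirschPoenaruImmersion` (stmt-SmoothPoincare4-7486).  Phillips' h-principle (PROVED in tree) on a
parallelisable open `U ⊋ Δ_e`; K–M Lemma 3.4/3.5 over the contractible `S ∖ pt`.  Sources: Hirsch1959, Poenaru1962,
Phillips1967, KervaireMilnor1963. -/
theorem stub_fakeBallImmersion :
    ∀ (S : Literature.Topology.FourManifolds.HomotopySphere 4) (e : EuclideanSpace ℝ (Fin 4) → S.carrier), Manifold.IsSmoothEmbedding (𝓡 4) (𝓡 4) ∞ e → ∃ F : S.carrier → EuclideanSpace ℝ (Fin 4), ∀ x, x ∉ e '' Metric.ball (0 : EuclideanSpace ℝ (Fin 4)) 1 → IsLocalDiffeomorphAt (𝓡 4) (𝓡 4) ∞ F x := by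
  exact Summit.SmoothPoincare4.SmoothPoincare4.Theorems.OrigamiFoldExistence.RoundTraceContinuity.stub_fakeBallImmersion

/-- STUB LM [the Lawson–Michelsohn handle theorem, a NAMED LITERATURE FACT] (r4): statement = VERBATIM the body of
`Literature.Geometry.Riemannian.LawsonMichelsohn1984_meanConvexIsotopy_of_handles` (vendored p86775, `[cite:
LawsonMichelsohn1984, Thm (3.1) + proof of Thm (6.1)]`); it closes by `exact …_holds` the day the Literature discharges
the fact (literature-prover debt), and is registered so that the line's dependence on it is visible by name.  Why it
might fail: it is a theorem in print (Invent. Math. 77 (1984)); formally XL. -/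
theorem stub_lawsonMichelsohn1984 :
    ∀ (m : ℕ) (M : Type) [TopologicalSpace M] [T2Space M] [SecondCountableTopology M] [ChartedSpace (EuclideanSpace ℝ (Fin (m + 1))) M] [IsManifold (𝓡 (m + 1)) ∞ M] (F : M → EuclideanSpace ℝ (Fin (m + 1))) (g : M → ℝ) (V : Set M), ContMDiff (𝓡 (m + 1)) 𝓘(ℝ, ℝ) ∞ g → IsCompact {x | g x ≤ 0} → (∀ x, g x ≤ 0 → IsLocalDiffeomorphAt (𝓡 (m + 1)) (𝓡 (m + 1)) ∞ F x) → (∀ x, g x ≤ 0 → Literature.Topology.FourManifolds.IsMCriticalPt (𝓡 (m + 1)) g x → g x < 0 ∧ (Literature.Topology.FourManifolds.mhessian (𝓡 (m + 1)) g x).Nondegenerate ∧ Literature.Topology.FourManifolds.morseIndex (𝓡 (m + 1)) g x + 1 ≤ m) → IsOpen V → {x | g x ≤ 0} ⊆ V → ∃ φ : M ≃ₘ⟮𝓡 (m + 1), 𝓡 (m + 1)⟯ M, (∀ x, x ∉ V → φ x = x) ∧ (∀ x, g x ≤ 0 → g (φ x) ≤ 0) ∧ ∀ y, g (φ.symm y)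 = 0 → ∀ σ : EuclideanSpace ℝ (Fin (m + 1)) → M, σ (F y) = y → ContMDiffAt (𝓡 (m + 1)) (𝓡 (m + 1)) ∞ σ (F y) → (∀ᶠ z in 𝓝 (F y), F (σ z) = z) → fderiv ℝ (fun z => g (φ.symm (σ z))) (F y) ≠ 0 ∧ ∀ v : Fin m → EuclideanSpace ℝ (Fin (m + 1)), Orthonormal ℝ v → (∀ i, fderiv ℝ (fun z => g (φ.symm (σ z))) (F y) (v i) = 0) → 0 < ∑ i, iteratedFDeriv ℝ 2 (fun z => g (φ.symm (σ z))) (F y) ![v i, v i] := by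
  sorry

/-- STUB 2b' [mean-convex re-embedding of a presented fake ball] (r4; CLOSED IN THE KERNEL by the wave-2 worker's
reduction `meanConvexReembedding_of_presentation`, file work/stubs/stub_meanConvexReembedding_reduction_slim.lean, to be
landed as the stub file): apply the L–M fact with `m := 3`, `M := S`, the developing map `F`, `V := univ`; transport the
fake-ball property along the ambient `φ` (`φ(Δ_e) ⊆ Δ_e`, `e' := φ ∘ e`, `IsSmoothEmbedding.diffeomorph_comp`); read
`H > 0` of the level set in the flat chart `σ = e' ∘ (F ∘ e')⁻¹_loc` as `CreaseMeanConvexAt (F ∘ e') u` by the landed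
criterion `Literature.Geometry.Riemannian.SphereCollar.creaseMeanConvex_of_levelSet` (p88080).  Sources:
LawsonMichelsohn1984 §3; wave-2 report work/stubs/stub_meanConvexReembedding.report.md. -/
theorem stub_meanConvexReembeddingOfPresentation :
    (∀ (m : ℕ) (M : Type) [TopologicalSpace M] [T2Space M] [SecondCountableTopology M] [ChartedSpace (EuclideanSpace ℝ (Fin (m + 1))) M] [IsManifold (𝓡 (m + 1)) ∞ M] (F : M → EuclideanSpace ℝ (Fin (m + 1))) (g : M → ℝ) (V : Set M), ContMDiff (𝓡 (m + 1)) 𝓘(ℝ, ℝ) ∞ g → IsCompact {x | g x ≤ 0} → (∀ x, g x ≤ 0 → IsLocalDiffeomorphAt (𝓡 (m + 1)) (𝓡 (m + 1)) ∞ F x) → (∀ x, g x ≤ 0 → Literature.Topology.FourManifolds.IsMCriticalPt (𝓡 (m + 1)) g x → g x < 0 ∧ (Literature.Topology.FourManifolds.mhessian (𝓡 (m + 1)) g x).Nondegenerate ∧ Literature.Topology.FourManifolds.morseIndex (𝓡 (m + 1)) g x + 1 ≤ m) → IsOpen V → {x | g x ≤ 0} ⊆ V → ∃ φ : M ≃ₘ⟮𝓡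 (m + 1), 𝓡 (m + 1)⟯ M, (∀ x, x ∉ V → φ x = x) ∧ (∀ x, g x ≤ 0 → g (φ x) ≤ 0) ∧ ∀ y, g (φ.symm y) = 0 → ∀ σ : EuclideanSpace ℝ (Fin (m + 1)) → M, σ (F y) = y → ContMDiffAt (𝓡 (m + 1)) (𝓡 (m + 1)) ∞ σ (F y) → (∀ᶠ z in 𝓝 (F y), F (σ z) = z) → fderiv ℝ (fun z => g (φ.symm (σ z))) (F y) ≠ 0 ∧ ∀ v : Fin m → EuclideanSpace ℝ (Fin (m + 1)), Orthonormal ℝ v → (∀ i, fderiv ℝ (fun z => g (φ.symm (σ z))) (F y) (v i) = 0) → 0 < ∑ i, iteratedFDeriv ℝ 2 (fun z => g (φ.symm (σ z))) (F y) ![v i, v i]) → ∀ (S : Literature.Topology.FourManifolds.HomotopySphere 4) (e : EuclideanSpace ℝ (Fin 4) → S.carrier) (F : S.carrier → EuclideanSpace ℝ (Fin 4)) (g : S.carrier → ℝ), ContMDiff (𝓡 4) 𝓘(ℝ, ℝ) ∞ g → {x | g x ≤ 0} = {x | x ∉ e '' Metric.ball (0 : EuclideanSpace ℝ (Fin 4))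 1} → (∀ x, g x ≤ 0 → Literature.Topology.FourManifolds.IsMCriticalPt (𝓡 4) g x → g x < 0 ∧ (Literature.Topology.FourManifolds.mhessian (𝓡 4) g x).Nondegenerate ∧ Literature.Topology.FourManifolds.morseIndex (𝓡 4) g x + 1 ≤ 3) → (Manifold.IsSmoothEmbedding (𝓡 4) (𝓡 4) ∞ e ∧ ∀ x, x ∉ e '' Metric.ball (0 : EuclideanSpace ℝ (Fin 4)) 1 → IsLocalDiffeomorphAt (𝓡 4) (𝓡 4) ∞ F x) → ∃ e' : EuclideanSpace ℝ (Fin 4) → S.carrier, (Manifold.IsSmoothEmbedding (𝓡 4) (𝓡 4) ∞ e' ∧ ∀ x, x ∉ e' '' Metric.ball (0 : EuclideanSpace ℝ (Fin 4)) 1 → IsLocalDiffeomorphAt (𝓡 4) (𝓡 4) ∞ F x) ∧ ∀ u : EuclideanSpace ℝ (Fin 4), ‖u‖ = 1 → (∀ w : Fin 3 → EuclideanSpace ℝ (Fin 4), (∀ i, ⟪w i, u⟫ = 0) → Orthonormal ℝ (fun i => fderiv ℝ (F ∘ e') u (w i)) → ∑ i, ‖w i‖ ^ 2 < ∑ i,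 ⟪(fderiv ℝ (F ∘ e') u).inverse (fderiv ℝ (fun x => fderiv ℝ (F ∘ e') x (w i)) u (w i)), u⟫) := by
  exact Summit.SmoothPoincare4.SmoothPoincare4.Theorems.OrigamiFoldExistence.RoundTraceContinuity.stub_meanConvexReembeddingOfPresentation

/-- STUB 2d [Morse fake ball] (r4; M-sized, provable now).  Let `f` be Morse on `S` without index-1 critical points.
Sublevel sets `{f ≤ c}` acquire a `k`-handle at each index-`k` critical value; with no index 1, components born at
index-0 points never merge, and `S` is connected, so `f` has a UNIQUE minimum `q` (dually: `h := −f` has no index 3 and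
a unique maximum).  For `c = f q + ε` below every other critical value, `{f < c}` is a Morse-chart round ball about `q`
(`IsMorse.exists_chart_eq_quadratic_holds`; finiteness `IsMorse.finite_criticalSet_holds`); its radial reparametrisation
is a smooth embedding `e : ℝ⁴ ↪ S` with `e(B̊⁴) = {f < c}` (tree `BallStretch`), and `g := −f − (−c) = c' − f`… precisely
`g := h − h₀` with `h := −f`, `h₀ := −c`: `{g ≤ 0} = {f ≥ c} = S ∖ e(B̊⁴) = Δ_e`, `g` is smooth, its critical points in
`{g ≤ 0}` are the critical points `x ≠ q` of `f`, where `g x < 0` (no critical value on the cut level), the Hessian is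
nondegenerate, and `morseIndex g x = morseIndex (−f) x = 4 − morseIndex f x ∈ {0, 1, 2}` because `morseIndex f x ∈
{2, 3, 4}` there (index 0 only at `q`, index 1 excluded) — i.e. `morseIndex g x + 1 ≤ 3`: `Δ_e` is a (0,1,2)-handlebody
PRESENTED IN MORSE FORM, exactly the hypothesis of STUB 2b'.  (B1-lite of the wave-2 report: no disc theorem is needed
because STUB 2 only asks for SOME `e`.)  Why it might fail: it cannot mathematically; formally M–L (unique-minimum count
= π₀ bookkeeping of sublevel sets, `sigNeg` of `−H` versus `H`).  Sources: Milnor1963 §3 (Thm 3.1, 3.2), Milnor1965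
§3, tree `BallStretch`, `OneMaxBall`, `SphereGenusSplitting.SphereHeight`. -/
theorem stub_morseFakeBall :
    ∀ S : Literature.Topology.FourManifolds.HomotopySphere 4, (∃ f : S.carrier → ℝ, Literature.Topology.FourManifolds.IsMorse (𝓡 4) f ∧ Literature.Topology.FourManifolds.criticalSetOfIndex (𝓡 4) f 1 = ∅) → ∃ (e : EuclideanSpace ℝ (Fin 4) → S.carrier) (g : S.carrier → ℝ), Manifold.IsSmoothEmbedding (𝓡 4) (𝓡 4) ∞ e ∧ ContMDiff (𝓡 4) 𝓘(ℝ, ℝ) ∞ g ∧ {x | g x ≤ 0} = {x | x ∉ e '' Metric.ball (0 : EuclideanSpace ℝ (Fin 4)) 1} ∧ ∀ x, g x ≤ 0 → Literature.Topology.FourManifolds.IsMCriticalPt (𝓡 4) g x → g x < 0 ∧ (Literature.Topology.FourManifolds.mhessian (𝓡 4) g x).Nondegenerate ∧ Literature.Topology.FourManifolds.morseIndex (𝓡 4) g x + 1 ≤ 3 := by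
  exact Summit.SmoothPoincare4.SmoothPoincare4.Theorems.OrigamiFoldExistence.RoundTraceContinuity.stub_morseFakeBall

/-- STUB 2 [mean-convex thickening] is the COMPOSITE of stubs 2d, 2a, LM, 2b' (r4): a Morse ball with a Morse-form
presentation of its fake ball (2d), an immersion of the fake ball (2a), and the L–M re-embedding (2b' under LM). -/
theorem meanConvexThickening_of (hLM : LawsonMichelsohnFact) (h2a : FakeBallImmersion)
    (h2b : MeanConvexReembeddingOfPresentation) (h2d : MorseFakeBall) : MeanConvexThickening := by
  intro S hS
  obtain ⟨e, g, he, hg, hgset, hcrit⟩ := h2d S hS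
  obtain ⟨F, hF⟩ := h2a S e he
  obtain ⟨e', he', hmc⟩ := h2b hLM S e F g hg hgset hcrit ⟨he, hF⟩
  exact ⟨e', F, he', hmc⟩

/-- STUB 3 [PATH] — HARDEST, the load-bearing open statement of the line. The mean-convex crease
`F ∘ e` of an immersed fake ball is the time-0 germ of a MEAN-CONVEX UNWINDING: a jointly smooth
family of collar germs `g t`, local diffeomorphisms along `S³`, mean-convex towards the outer side for
all `t ∈ [0,1]`, ending with a crease inside a round sphere. A flexibility statement about
mean-convex immersions `S³ ↬ ℝ⁴` in the standard Smale class (the crease of an immersed fake ball IS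
Smale-standard: the clutching class of `T(Δ ∪ B⁴)` has `(p₁, e) = (0, 2)` as for S⁴ — triage r1-1),
with the extra datum that the start bounds an immersed flat homotopy ball. Why plausibly true:
Gromov's h-principle for the open, `Diff`-invariant relation `H > 0` on the OPEN manifold `S³ ∖ pt`
makes any two regularly homotopic mean-convex immersions homotopic through immersions mean-convex off
a small 3-disc, so the content is concentrated; outward fingers and tubes retract mean-convexly
(n = 1 analogue: Whitney–Graustein for locally convex curves of index 1); 2-convex embedded spheres
in ℝⁿ⁺¹ form a path-connected space (Buzano–Haslhofer–Hershkovits arXiv:1607.05604 Main Theorem, by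
mean curvature flow with surgery, marble trees). Why it might fail / what it costs: with STUB 4 it
implies that every mean-convexly immersed fake ball is `B⁴`, hence (STUBS 1–2) that every
contractible 4-dimensional 2-handlebody bounded by S³ is a ball — the Andrews–Curtis /
Akbulut–Kirby territory of `Literature.Barriers.SmoothPoincare4.StrictPropertyTwoRBarrier` (no
handle slide or Property R is used, so the barrier does not bite formally; the bet is that
mean-convex regular homotopy is a richer move set than 2-handle slides — it preserves no handle
structure — yet rigid enough for STUB 4); and even for `Δ_e ≅ B⁴` it contains the open
path-connectedness of mean-convex (not 2-convex) spheres in ℝ⁴, where mean curvature flow has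
bubble-sheet (`S¹ × ℝ²`) singularities and no surgery (Huisken–Sinestrari 2009 needs 2-convexity).
Sources: Smale1959 (Ann. Math. 69); Gromov1986 (PDR, open Diff-invariant relations);
BuzanoHaslhoferHershkovits2021 (arXiv:1607.05604, JDG 118); HuiskenSinestrari2009 (Invent. Math.
175); GompfScharlemannThompson2010 (arXiv:1103.1601); Gompf1991Killing. Size: open-problem. -/
theorem stub_meanConvexUnwinding :
    ∀ (S : Literature.Topology.FourManifolds.HomotopySphere 4) (e : EuclideanSpace ℝ (Fin 4) → S.carrier) (F : S.carrier → EuclideanSpace ℝ (Fin 4)), (Manifold.IsSmoothEmbedding (𝓡 4) (𝓡 4) ∞ e ∧ ∀ x, x ∉ e '' Metric.ball (0 : EuclideanSpace ℝ (Fin 4)) 1 → IsLocalDiffeomorphAt (𝓡 4) (𝓡 4) ∞ F x) → (∀ u : EuclideanSpace ℝ (Fin 4), ‖u‖ = 1 → (∀ w : Fin 3 → EuclideanSpace ℝ (Fin 4), (∀ i, ⟪w i, u⟫ = 0) → Orthonormal ℝ (fun i => fderiv ℝ (F ∘ e) u (w i)) → ∑ i, ‖w i‖ ^ 2 < ∑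 i, ⟪(fderiv ℝ (F ∘ e) u).inverse (fderiv ℝ (fun x => fderiv ℝ (F ∘ e) x (w i)) u (w i)), u⟫)) → ∃ (g : ℝ → EuclideanSpace ℝ (Fin 4) → EuclideanSpace ℝ (Fin 4)) (c : EuclideanSpace ℝ (Fin 4)) (r : ℝ), g 0 = F ∘ e ∧ ((∀ t ∈ Set.Icc (0 : ℝ) 1, ∀ u : EuclideanSpace ℝ (Fin 4), ‖u‖ = 1 → ContDiffAt ℝ ∞ (Function.uncurry g) (t, u) ∧ Function.Bijective (fderiv ℝ (g t) u) ∧ (∀ w : Fin 3 → EuclideanSpace ℝ (Fin 4), (∀ i, ⟪w i, u⟫ = 0) → Orthonormal ℝ (fun i => fderiv ℝ (g t) u (w i)) → ∑ i, ‖w i‖ ^ 2 < ∑ i, ⟪(fderiv ℝ (g t) u).inverse (fderiv ℝ (fun x => fderiv ℝ (g t) x (w i)) u (w i)), u⟫)) ∧ ∀ u : EuclideanSpace ℝ (Fin 4), ‖u‖ = 1 → dist (g 1 u) c = r) := by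
  sorry

/-- STUB 4 [MCR] — the FLAT CONTINUITY PRINCIPLE (the card's OPEN + CLOSED on the flat locus;
triage sharpen (1); XL, the analysis is in print). Let `T = {t ∈ [0,1] : some immersion F_t of Δ_e
has collar germ F_t ∘ e = g t near S³}`; `0 ∈ T` by hypothesis. OPEN: for `t'` near `t ∈ T`,
`g t'` is C¹-close to `g t = F_t ∘ e` near `S³`, so `ψ = (F_t ∘ e)⁻¹_loc ∘ g t'` (patchwise local
inverse, uniform by compactness) is a diffeomorphism of a collar neighbourhood close to `id`; extend
it by a cut-off and put `F_{t'} = F_t ∘ (e ψ e⁻¹)`. CLOSED: for `tₙ → t*` in `T` the flat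
hyperkähler triples `Fₙ*θ` on `Δ_e` (oriented, compact, `H₂(Δ_e; ℤ) = 0` so no class of square
`-2`) have boundary framings `e_*(g tₙ)*θ|S³ → e_*(g t*)*θ|S³` smoothly, and the limit framing has
`H > 0` (mean-convexity at `t*`; uniform on `[0,1] × S³` by compactness), so by Liu's compactness
theorem (arXiv:2202.07151 = Duke Math. J. 2024, Thm 1.2; properness Prop 4.13) a subsequence
converges in Cheeger–Gromov sense to a hyperkähler triple `ω` on `Δ_e` with `ω|∂ = γ_{t*}` EXACTLY;
`ω` is flat (smooth limit of flat), so it develops: `D : Δ_e ↬ ℝ⁴` with `D*θ = ω` (simply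
connected; fix the SO(3)-ambiguity by a rotation of ℍ); the closed framing determines the boundary
metric AND second fundamental form (Fine–Lotay–Singer arXiv:1603.08170 p. 5; Liu p. 2), so
`D ∘ e|S³` and `g t*|S³` differ by a rigid motion `A` (fundamental theorem of hypersurfaces), and
after a collar reparametrisation `A⁻¹ ∘ D` has germ `g t*`: `t* ∈ T`. Hence `1 ∈ T`. (A purely
flat proof — Cheeger–Gromov for flat manifolds with boundary: `K ≡ 0`, focal bound
`dist(·, ∂) ≤ 3/H_min`, `exp` injective below the distance to the boundary by developing, no thin
necks because `H ≤ H_max` — is an alternative to citing Liu.) The line USES `H > 0` here: without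
it closedness fails (immersed dumbbell whose band is pushed through itself). Why it might fail: only
through the collar bookkeeping (sides, two-sided germs, the reparametrisation `ψ`), not the
analysis. Sources: Liu2024 (arXiv:2202.07151) Thm 1.2, Prop 4.13; FineLotaySinger2017
(arXiv:1603.08170) §1.1, Thm 1.6; Donaldson2017 (arXiv:1708.01649) §2; Bryant2010 (thickening).
Size: XL (Liu 1.2 to be vendored as a cite fact; hyperkähler triples / closed framings are not in
the tree). -/
theorem stub_flatContinuity :
    ∀ (S : Literature.Topology.FourManifolds.HomotopySphere 4) (e : EuclideanSpace ℝ (Fin 4) → S.carrier) (F : S.carrier → EuclideanSpace ℝ (Fin 4)) (g : ℝ → EuclideanSpace ℝ (Fin 4) → EuclideanSpace ℝ (Fin 4)) (c : EuclideanSpace ℝ (Fin 4)) (r : ℝ), (Manifold.IsSmoothEmbedding (𝓡 4) (𝓡 4) ∞ e ∧ ∀ x, x ∉ e '' Metric.ball (0 : EuclideanSpace ℝ (Fin 4)) 1 → IsLocalDiffeomorphAt (𝓡 4) (𝓡 4) ∞ F x) → g 0 = F ∘ e → ((∀ t ∈ Set.Icc (0 : ℝ) 1, ∀ u : EuclideanSpace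 ℝ (Fin 4), ‖u‖ = 1 → ContDiffAt ℝ ∞ (Function.uncurry g) (t, u) ∧ Function.Bijective (fderiv ℝ (g t) u) ∧ (∀ w : Fin 3 → EuclideanSpace ℝ (Fin 4), (∀ i, ⟪w i, u⟫ = 0) → Orthonormal ℝ (fun i => fderiv ℝ (g t) u (w i)) → ∑ i, ‖w i‖ ^ 2 < ∑ i, ⟪(fderiv ℝ (g t) u).inverse (fderiv ℝ (fun x => fderiv ℝ (g t) x (w i)) u (w i)), u⟫)) ∧ ∀ u : EuclideanSpace ℝ (Fin 4), ‖u‖ = 1 → dist (g 1 u) c = r) → ∃ F₁ : S.carrier → EuclideanSpace ℝ (Fin 4), (Manifold.IsSmoothEmbedding (𝓡 4) (𝓡 4) ∞ e ∧ ∀ x, x ∉ e '' Metric.ball (0 : EuclideanSpace ℝ (Fin 4)) 1 → IsLocalDiffeomorphAt (𝓡 4) (𝓡 4) ∞ F₁ x) ∧ ∀ u : EuclideanSpace ℝ (Fin 4), ‖u‖ = 1 → dist (F₁ (e u)) c = r := by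
  sorry

/-- STUB 5 [round crease ⇒ S ≅ S⁴, under Cerf Γ₄ = 0] — LEAD RESHAPE r1: now VERBATIM route
EuclideanOrigami's support item `RoundCreaseStandard` (stmt-SmoothPoincare4-10644), i.e. the planner's
STUB 5 with its Cerf antecedent moved OUT of the proof obligation and INTO the statement (the composition
discharges it with the by-name route item `CerfGammaFour`, stmt-SmoothPoincare4-8758 — the tree's named fact
`Literature.Topology.FourManifolds.cerf_twistedSphere_four`, XL formal debt reduced in tree to the leaf
`cerf_pi0DiffDisc_relBoundary_three`, twice parked by fact seats; it is ROUTE debt, already an item, not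
line content).  What remains is the card's TraceRung read on the flat locus: if the crease of an immersed
fake ball lies in the round sphere `S_r(c)` then `r > 0`, `F ∘ e|S³ → S_r(c)` is a local diffeomorphism of
3-spheres hence a diffeomorphism, `F` is injective on `Δ_e` (sheet counting: EuclideanOrigami item
`CoveringLemma` stmt-SmoothPoincare4-7482, proved pattern `exists_homeomorph_image_eq_sphereEquator_holds`),
`F(Δ_e)` is the closed round ball, `Δ_e ≅ D⁴` compatibly with `e`, so `S = e(D⁴) ∪ Δ_e` is a twisted
sphere (`Literature.Topology.FourManifolds.TwistedSphere`) and the antecedent gives `S ≅ S⁴`.  Why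
plausibly true: a theorem (Palais disc theorem + covering bookkeeping).  Why it might fail: it cannot
mathematically; formally the covering-space step and the `TwistedSphere` packaging are L–XL.  Sources:
Cerf1968; Palais1960; KervaireMilnor1963; Brown1960.  Size: L–XL formal (shared with stmt-10644). -/
theorem stub_roundCreaseStandard :
    (∀ [Fact (Literature.Topology.FourManifolds.isSmoothEmbedding_sphereInclusion' 3)] (φ : (Metric.sphere (0 : EuclideanSpace ℝ (Fin 4)) 1) ≃ₘ⟮𝓡 3, 𝓡 3⟯ (Metric.sphere (0 : EuclideanSpace ℝ (Fin 4)) 1)) (T : Literature.Topology.FourManifolds.TwistedSphere 3 φ), Nonempty (T.carrier ≃ₘ⟮𝓡 4, 𝓡 4⟯ Metric.sphere (0 : EuclideanSpace ℝ (Fin 5)) 1)) → ∀ (S : Literature.Topology.FourManifolds.HomotopySphere 4) (e : EuclideanSpace ℝ (Fin 4) → S.carrier) (F : S.carrier → EuclideanSpace ℝ (Fin 4)), Manifold.IsSmoothEmbedding (𝓡 4) (𝓡 4) ∞ e → (∀ x, x ∉ e '' Metric.ball (0 : EuclideanSpace ℝ (Fin 4)) 1 → IsLocalDiffeomorphAt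 (𝓡 4) (𝓡 4) ∞ F x) → (∃ (c : EuclideanSpace ℝ (Fin 4)) (r : ℝ), ∀ u : EuclideanSpace ℝ (Fin 4), ‖u‖ = 1 → dist (F (e u)) c = r) → Nonempty (S.carrier ≃ₘ⟮𝓡 4, 𝓡 4⟯ Metric.sphere (0 : EuclideanSpace ℝ (Fin 5)) 1) := by
  exact Summit.SmoothPoincare4.SmoothPoincare4.Theorems.OrigamiFoldExistence.RoundTraceContinuity.stub_roundCreaseStandard

/-- STUB 6 [transport] (M, provable now): the fold data of `OrigamiRung` transport along a
diffeomorphism `φ : M ≃ₘ M'` — pull back `V i ↦ φ⁻¹(V i)`, keep `(N i, s i, S i, b i)`, replace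
`β i ↦ β i ∘ φ` and the fold parametrisation `z ↦ φ.symm ∘ z`; disjointness / non-emptiness /
connectedness of the complement, `IsSmoothEmbedding`, `ContMDiffOn` on `φ⁻¹ U`, injectivity, images,
bijectivity of `mfderiv (β i ∘ φ) = mfderiv (β i) ∘ mfderiv φ` and the rank-1 kernel on the frontier
are invariant (`Diffeomorph` is a homeomorphism: `closure`/`frontier` commute with `φ⁻¹`). With the
route item `RoundSphereIsOrigamiFold = FoldData S⁴` it yields `FoldData M` from `M ≅ S⁴`. Why it
might fail: it cannot (transport of structure); the work is mfderiv chain rules under binders.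
Sources: Lee2013 (Prop. 3.6, Cor. 3.7); Hirsch1976. Size: M. -/
theorem stub_foldDataTransport :
    ∀ (M : Type) [TopologicalSpace M] [T2Space M] [SecondCountableTopology M]
      [ChartedSpace (EuclideanSpace ℝ (Fin 4)) M] [IsManifold (𝓡 4) ∞ M]
      (M' : Type) [TopologicalSpace M'] [T2Space M'] [SecondCountableTopology M']
      [ChartedSpace (EuclideanSpace ℝ (Fin 4)) M'] [IsManifold (𝓡 4) ∞ M'],
      Nonempty (M ≃ₘ⟮𝓡 4, 𝓡 4⟯ M') → FoldData M' → FoldData M := by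
  intro M _ _ _ _ _ M' _ _ _ _ _ hΦ h
  obtain ⟨Φ⟩ := hΦ
  exact Summit.SmoothPoincare4.SmoothPoincare4.Theorems.OrigamiFoldExistence.Negative.foldData_transport Φ h

/-! ### Consistency: each named statement IS its registered stub (definitionally) -/

theorem noOneHandles_holds : NoOneHandles := stub_noOneHandles
theorem fakeBallImmersion_holds : FakeBallImmersion := stub_fakeBallImmersion
theorem lawsonMichelsohnFact_holds : LawsonMichelsohnFact := stub_lawsonMichelsohn1984
theorem meanConvexReembeddingOfPresentation_holds : MeanConvexReembeddingOfPresentation :=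
  stub_meanConvexReembeddingOfPresentation
theorem morseFakeBall_holds : MorseFakeBall := stub_morseFakeBall
theorem meanConvexThickening_holds : MeanConvexThickening :=
  meanConvexThickening_of stub_lawsonMichelsohn1984 stub_fakeBallImmersion
    stub_meanConvexReembeddingOfPresentation stub_morseFakeBall
theorem meanConvexUnwinding_holds : MeanConvexUnwinding := fun S e F hF hmc => stub_meanConvexUnwinding S e F hF hmc
theorem flatContinuity_holds : FlatContinuity := fun S e F g c r hF hg0 hg => stub_flatContinuity S e F g c r hF hg0 hg
theorem roundCreaseStandard_holds : RoundCreaseStandard := stub_roundCreaseStandard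
theorem foldDataTransport_holds : FoldDataTransport := stub_foldDataTransport

/-! ### Name-keyed aliases of the six statements (the hypotheses of the composition) -/
namespace Registered

/-- Alias of `NoOneHandles` keyed by the registered stub name. -/
abbrev stub_noOneHandles : Prop := NoOneHandles
/-- Alias of `FakeBallImmersion` keyed by the registered stub name. -/
abbrev stub_fakeBallImmersion : Prop := FakeBallImmersion
/-- Alias of `LawsonMichelsohnFact` keyed by the registered stub name. -/
abbrev stub_lawsonMichelsohn1984 : Prop := LawsonMichelsohnFact
/-- Alias of `MeanConvexReembeddingOfPresentation` keyed by the registered stub name. -/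
abbrev stub_meanConvexReembeddingOfPresentation : Prop := MeanConvexReembeddingOfPresentation
/-- Alias of `MorseFakeBall` keyed by the registered stub name. -/
abbrev stub_morseFakeBall : Prop := MorseFakeBall
/-- Alias of `MeanConvexUnwinding` keyed by the registered stub name. -/
abbrev stub_meanConvexUnwinding : Prop := MeanConvexUnwinding
/-- Alias of `FlatContinuity` keyed by the registered stub name. -/
abbrev stub_flatContinuity : Prop := FlatContinuity
/-- Alias of `RoundCreaseStandard` keyed by the registered stub name. -/
abbrev stub_roundCreaseStandard : Prop := RoundCreaseStandard
/-- Alias of `FoldDataTransport` keyed by the registered stub name. -/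
abbrev stub_foldDataTransport : Prop := FoldDataTransport

end Registered

/-! ### Registry text (lead r4)
The registered `stub_*` statements above are written FULLY EXPANDED (no local notation, no local predicate), because
`propose --supports` files are matched against the registry textually; the named `Prop`s (`MeanConvexUnwinding`, …)
keep the readable form and the `*_holds` lemmas witness that the two agree definitionally. -/

/-! ### Glue (proved) -/

/-- [MC-START] from STUBS 1–2: every homotopy 4-sphere has an immersed fake ball with mean-convex
crease. -/
theorem meanConvexStart_of (h1 : NoOneHandles) (h2 : MeanConvexThickening) (S : HomotopySphere 4) :
    MeanConvexStart S :=
  h2 S (h1 S)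

/-- MC-START ⟶ PATH ⟶ MCR ⟶ round crease ⟶ `S ≅ S⁴` (under Cerf `Γ₄ = 0`), for every
`S : HomotopySphere 4`. -/
theorem nonempty_diffeomorph_sphere_of (h1 : NoOneHandles) (h2 : MeanConvexThickening)
    (h3 : MeanConvexUnwinding) (h4 : FlatContinuity) (h5 : RoundCreaseStandard)
    (hC : CerfTwistedSphereFour) (S : HomotopySphere 4) : Nonempty (S.carrier ≃ₘ⟮𝓡 4, 𝓡 4⟯ 𝕊⁴) := by
  obtain ⟨e, F, hF, hmc⟩ := meanConvexStart_of h1 h2 S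
  obtain ⟨g, c, r, hg0, hg⟩ := h3 S e F hF hmc
  obtain ⟨F₁, hF₁, hround⟩ := h4 S e F g c r hF hg0 hg
  exact h5 hC S e F₁ hF₁.1 hF₁.2 ⟨c, r, hround⟩

/-! ### The composition: the six stubs and the route item `RoundSphereIsOrigamiFold` imply the
crux, by name -/

/-- `OrigamiFoldExistence` from the registered stubs (1, LM, 2a, 2b', 2d, 3, 4; 5 and 6 proved), and the route's items
(stmt-7845) and `CerfGammaFour` (stmt-8758), by name (pure logic + the PROVED packaging theorems; no
`sorry`): a smooth `M` with `M ≃ₕ S⁴` is compact (`compactSpace_of_homotopyEquiv_sphere_four_holds`) and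
orientable (`isOrientable_of_homotopyEquiv_sphere_four_holds`), hence a `HomotopySphere 4`; the glue
gives `M ≅ S⁴`; transport the fold data of `S⁴`. -/
theorem OrigamiFoldExistence_of (h1 : Registered.stub_noOneHandles)
    (hLM : Registered.stub_lawsonMichelsohn1984) (h2a : Registered.stub_fakeBallImmersion)
    (h2b : Registered.stub_meanConvexReembeddingOfPresentation) (h2d : Registered.stub_morseFakeBall)
    (h3 : Registered.stub_meanConvexUnwinding) (h4 : Registered.stub_flatContinuity)
    (h5 : Registered.stub_roundCreaseStandard)
    (hR : RoundSphereIsOrigamiFold) (hC : CerfGammaFour) :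
    OrigamiFoldExistence := by
  intro M _ _ _ _ _ hM
  haveI : CompactSpace M :=
    Literature.Topology.FourManifolds.compactSpace_of_homotopyEquiv_sphere_four_holds M hM
  obtain ⟨o⟩ :=
    Literature.Topology.FourManifolds.isOrientable_of_homotopyEquiv_sphere_four_holds M hM
  have hφ : Nonempty (M ≃ₘ⟮𝓡 4, 𝓡 4⟯ 𝕊⁴) :=
    -- (r6: STUBS 2a, 2b', 2d, 5 are DISCHARGED above by their landed Theorems modules; they still enter BY NAME here
    --  because the registered composition is stated over all six stub names)
    nonempty_diffeomorph_sphere_of h1 (meanConvexThickening_of hLM h2a h2b h2d) h3 h4 h5 hC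
      ⟨M, o, ⟨hM⟩⟩
  -- STUB 6 is PROVED (r0: `Negative.foldData_transport`, p72874), so it is discharged here, not assumed
  exact foldDataTransport_holds M 𝕊⁴ hφ hR

/-- Wiring check: the registered stubs feed `OrigamiFoldExistence_of` as stated. -/
example (hR : RoundSphereIsOrigamiFold) (hC : CerfGammaFour) : OrigamiFoldExistence :=
  OrigamiFoldExistence_of stub_noOneHandles stub_lawsonMichelsohn1984 stub_fakeBallImmersion
    stub_meanConvexReembeddingOfPresentation stub_morseFakeBall stub_meanConvexUnwinding stub_flatContinuity
    stub_roundCreaseStandard hR hC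

/-- Bookkeeping: the route item `CerfGammaFour` IS `CerfTwistedSphereFour` (definitionally). -/
example : CerfGammaFour ↔ CerfTwistedSphereFour := Iff.rfl

end Summit.SmoothPoincare4.SmoothPoincare4.Cruxes.OrigamiFoldExistence.RoundTraceContinuity

end
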